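import Literature.Computability.AlgebraicComplexity.BI17OddPlethysmColumnSets
import Literature.Computability.AlgebraicComplexity.BI17HoweInvariantsProofs
import Literature.Computability.AlgebraicComplexity.HwvEvaluationRankBound
import Mathlib.LinearAlgebra.Dimension.StrongRankCondition
import Mathlib.LinearAlgebra.Basis.VectorSpace
import HarnessLib

/-!
# Ikenmeyer–Kandasamy 2020, Thm. 4.2: glue bricks B3 (the fundamental invariant `Φ`) and B4 (evaluation matrices)

Topic `Literature/Computability/AlgebraicComplexity` (val-lit cell, programme "IK20 #2", lead-bip
rulings 2026-08-27T01:54Z (C): bricks B3 + B4 → unit t02). Theorems only: no definition, no named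
fact, no instance, no notation.

Context. IK 2020 Thm. 4.2 (the Main Technical Theorem; tree fact `IK2020_thm_4_2`,
`IK20HighestWeightVectors.lean`) is proved in print (§13, TeX L1146–1210) from the Tableau Lifting
Theorem 13.1 (tree: `IK2020_thm_13_1_holds`), the functions on the orbit `GL_m p` of
`p = x₁^D + ⋯ + x_m^D` (§9–§10), BI 2017's fundamental invariant `Φ` (L1177–1184) and the final
count of linearly independent highest-weight vectors (L1207–1210). This file supplies the two
small glue steps of that proof which do not depend on tableaux:

* **B3** `IK2020.exists_slInvariant_hwv_aeval_psum_const` — §13, TeX L1177–1190: "there exists an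
  `SL_m`-invariant function `Φ` in `ℂ[\overline{Gp}]` with `Φ(p) = 1` … `Φ` has degree `m` [`D`
  even] / `2m` [`D` odd and `2m ≤ binom(2D, D)`]", and the products `Φ^{e_Ξ - e_ϱ}`
  (`Φ^{(e_Ξ - e_ϱ)/2}` for odd `D`): for every `e` (even if `D` is odd) a highest-weight vector
  `Ψ` of `ℂ[Sym^D ℂ^m]` of weight `(m × eD)^* = (-eD, …, -eD)` which is CONSTANT and non-zero on
  `SL_m · p`. `Φ` is the tree's Cayley invariant `cayleyP` (BI 2017 Thm. 3.18 (2),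
  `BI2017_thm_3_18_2_powerSum`, `cayleyP_mem_slInvariantsOfDegree`) for even `D` and BI 2017's
  tableau invariant of the proof of Prop. 3.24 (2) (`exists_tableau_aeval_psum_eq_factorial`,
  `tableauInvPoly_mem_slInvariantsOfDegree`) for odd `D`; the side condition
  `2(m-1) ≤ binom(2(D-1), D-1) ⇒ 2m ≤ binom(2D, D)` is re-proved here (Pascal's rule; the tree's
  copy in `IK2020Cor45PlethysmPositivity.lean` is private).
* **B4** `IK2020.exists_det_eval_ne_zero_of_linearIndependent` — the implicit step of TeX
  L1207–1210 ("the `f̄^{S_{ϱ,i}}` are linearly independent. It follows … that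
  `mult ≥ ∑ b(λ,ϱ,D,d)`"): finitely many `K`-linearly independent functions `X → K` admit points
  with non-singular evaluation matrix; and its composition with the tree's evaluation-rank bound
  `le_orbitMultiplicity_of_det_eval_ne_zero`:
  `IK2020.le_orbitMultiplicity_of_linearIndependent_sl` — highest-weight vectors of `ℂ[Sym^D]`
  whose restrictions to `SL_m · f` are linearly independent bound `orbitMultiplicity ℂ f D χ` below.

Consumer: the assembly `IK2020_thm_4_2_of_orbitFunctions` (file `IK2020Thm42OfOrbitFunctions.lean`,
to be written on bricks B1/B2 of units p4/t08). Honest framing: bookkeeping of IK's toy model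
`p = x₁^D + ⋯ + x_m^D`; VP ≠ VNP is NOT proved and nothing here is progress on it.

## References
* [IkenmeyerKandasamy2019] C. Ikenmeyer, U. Kandasamy, *Implementing geometric complexity theory:
  on the separation of orbit closures via symmetries*, STOC 2020 / arXiv:1911.03990, §13 (proof of
  Thm. 4.2), TeX L1146–1210.
* [BurgisserIkenmeyer2017] P. Bürgisser, C. Ikenmeyer, *Fundamental invariants of orbit closures*,
  J. Algebra 477 (2017), Thm. 3.18, Prop. 3.24.
-/

noncomputable section

open MvPolynomial
open scoped BigOperators

namespace Literature.Computability.AlgebraicComplexity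

open _root_.Literature.NumberTheory.DiophantineGeometry

namespace IK2020

/-! ## B4: evaluation matrices of linearly independent functions -/

/-- **Linearly independent functions have a non-singular evaluation matrix** (the implicit step
of IK 2020 §13, TeX L1207–1210, between "the `f̄^{S_{ϱ,i}}` are linearly independent" and
"`mult ≥ ∑ b`"): if `f_0, …, f_{r-1} : X → K` are `K`-linearly independent, there are points
`x_0, …, x_{r-1}` with `det (f_i(x_j)) ≠ 0`. (Proof: the evaluation vectors
`x ↦ (f_i(x))_i` span `K^r` — a functional vanishing on all of them is a linear relation —, so
`r` of them form a basis.) [cite: IkenmeyerKandasamy2019, §13 (proof of Thm. 4.2), TeX L1207–1210] -/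
theorem exists_det_eval_ne_zero_of_linearIndependent {K X : Type*} [Field K] {r : ℕ}
    (f : Fin r → X → K) (hf : LinearIndependent K f) :
    ∃ x : Fin r → X, (Matrix.of fun i j => f i (x j)).det ≠ 0 := by
  classical
  let ev : X → (Fin r → K) := fun x i => f i x
  -- the evaluation vectors span `K^r`
  have hspan : Submodule.span K (Set.range ev) = ⊤ := by
    by_contra hne
    obtain ⟨φ, hφ0, hφ⟩ :=
      Submodule.exists_le_ker_of_lt_top _ (lt_top_iff_ne_top.mpr hne)
    apply hφ0
    -- the coefficients `c_i = φ(e_i)` give a linear relation among the `f_i`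
    have hc : ∀ i, φ (Pi.single i 1) = 0 := by
      have hrel : ∑ i, φ (Pi.single i 1) • f i = 0 := by
        funext x
        have hx : φ (ev x) = 0 := LinearMap.mem_ker.mp (hφ (Submodule.subset_span ⟨x, rfl⟩))
        have hev : ev x = ∑ i, ev x i • (Pi.single i 1 : Fin r → K) := by
          funext j
          simp only [Finset.sum_apply, Pi.smul_apply, Pi.single_apply, smul_eq_mul, mul_ite,
            mul_one, mul_zero, Finset.sum_ite_eq, Finset.mem_univ, if_true]
        rw [hev, map_sum] at hx
        simp only [map_smul, smul_eq_mul] at hx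
        simp only [Finset.sum_apply, Pi.smul_apply, smul_eq_mul, Pi.zero_apply]
        rw [← hx]
        exact Finset.sum_congr rfl fun i _ => mul_comm _ _
      exact fun i => Fintype.linearIndependent_iff.mp hf _ hrel i
    refine (Pi.basisFun K (Fin r)).ext fun i => ?_
    rw [Pi.basisFun_apply, LinearMap.zero_apply]
    exact hc i
  -- extract a basis among the evaluation vectors and index it by `Fin r`
  obtain ⟨κ, a, -, hsp, hli⟩ := exists_linearIndependent' (K := K) ev
  rw [hspan] at hsp
  let B : Module.Basis κ K (Fin r → K) := Module.Basis.mk hli (by rw [hsp])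
  let e : κ ≃ Fin r := B.indexEquiv (Pi.basisFun K (Fin r))
  refine ⟨fun j => a (e.symm j), ?_⟩
  -- the evaluation matrix is the matrix of the basis `B.reindex e` in the standard basis
  have hB : LinearIndependent K (fun j => ev (a (e.symm j))) ∧
      Submodule.span K (Set.range fun j => ev (a (e.symm j))) = ⊤ := by
    have hfun : (fun j => ev (a (e.symm j))) = ⇑(B.reindex e) := by
      funext j
      rw [Module.Basis.reindex_apply, Module.Basis.mk_apply]
      rfl
    rw [hfun]
    exact ⟨(B.reindex e).linearIndependent, (B.reindex e).span_eq⟩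
  have hunit := (Module.Basis.is_basis_iff_det (Pi.basisFun K (Fin r))).mp hB
  rw [Module.Basis.det_apply] at hunit
  have hmat : (Pi.basisFun K (Fin r)).toMatrix (fun j => ev (a (e.symm j))) =
      Matrix.of fun i j => f i (a (e.symm j)) := by
    ext i j
    rw [Module.Basis.toMatrix_apply, Pi.basisFun_repr, Matrix.of_apply]
  rw [hmat] at hunit
  exact hunit.ne_zero

/-- **B4 ∘ the evaluation-rank bound** (IK 2020 §13, TeX L1207–1210: "Since each `f̄^{S_{ϱ,i}}`
coincides with `f^{S_{ϱ,i}}` when restricted to `SL_m p` (up to a nonzero factor), the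
`f̄^{S_{ϱ,i}}` are linearly independent. It follows … [that] `mult ≥ ∑ b`"): highest-weight
vectors `F_0, …, F_{r-1}` of weight `χ` in `ℂ[Sym^D ℂ^m]` whose restrictions
`s ↦ F_i(s · f)` to the `SL_m`-orbit of a form `f` are linearly independent functions on
`SL_m(ℂ)` give `#ι ≤ mult_χ ℂ[\overline{GL_m f}]` (tree `orbitMultiplicity`; any finite index type `ι`).
[cite: IkenmeyerKandasamy2019, §13 (proof of Thm. 4.2), TeX L1207–1210] -/
theorem le_orbitMultiplicity_of_linearIndependent_sl {m D : ℕ} (hD : D ≠ 0) {χ : Weight (Fin m)}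
    {ι : Type*} [Fintype ι] (F : ι → MvPolynomial (DegIdx (Fin m) D) ℂ)
    (hF : ∀ i, F i ∈ highestWeightSpace (coordRep (Fin m) ℂ D) χ) (f : MvPolynomial (Fin m) ℂ)
    (hli : LinearIndependent ℂ fun i (s : Matrix.SpecialLinearGroup (Fin m) ℂ) =>
      aeval (formCoeff D (linSubst (Fin m) ℂ (s : Matrix (Fin m) (Fin m) ℂ) f)) (F i)) :
    Fintype.card ι ≤ orbitMultiplicity ℂ f D χ := by
  -- reindex by `Fin (card ι)`
  set e := (Fintype.equivFin ι).symm with he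
  have hli' : LinearIndependent ℂ fun j (s : Matrix.SpecialLinearGroup (Fin m) ℂ) =>
      aeval (formCoeff D (linSubst (Fin m) ℂ (s : Matrix (Fin m) (Fin m) ℂ) f)) (F (e j)) :=
    hli.comp e e.injective
  obtain ⟨s, hs⟩ := exists_det_eval_ne_zero_of_linearIndependent _ hli'
  refine le_orbitMultiplicity_of_det_eval_ne_zero hD (fun j => F (e j)) (fun j => hF (e j))
    (fun j => Matrix.SpecialLinearGroup.toGL (s j)) ?_
  simpa only [linSubstRep_apply, Matrix.SpecialLinearGroup.coe_GL_coe_matrix] using hs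

/-! ## B3: the fundamental invariant `Φ` and its powers -/

/-- From IK's hypothesis `2(m-1) ≤ binom(2(D-1), D-1)` (with `3 ≤ D ≤ m`) to BI 2017's
`2m ≤ binom(2D, D)`, by Pascal's rule (re-proof of the private helper of
`IK2020Cor45PlethysmPositivity.lean`; IK Thm. 4.2 hypothesis, TeX L391, versus §13, L1183).
[cite: IkenmeyerKandasamy2019, Thm. 4.2 and §13, TeX L391 and L1183] -/
theorem two_mul_le_choose_of_le_choose_pred' {m D : ℕ} (hD : 3 ≤ D) (hm : D ≤ m)
    (h : 2 * (m - 1) ≤ Nat.choose (2 * (D - 1)) (D - 1)) : 2 * m ≤ Nat.choose (2 * D) D := by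
  obtain ⟨D', rfl⟩ : ∃ D', D = D' + 1 := ⟨D - 1, by omega⟩
  simp only [Nat.add_sub_cancel] at h
  have hP : Nat.choose (2 * (D' + 1)) (D' + 1) =
      Nat.choose (2 * D' + 1) D' + Nat.choose (2 * D' + 1) (D' + 1) := by
    rw [show 2 * (D' + 1) = (2 * D' + 1) + 1 by ring, Nat.choose_succ_succ]
  have hS : Nat.choose (2 * D' + 1) (D' + 1) = Nat.choose (2 * D' + 1) D' :=
    Nat.choose_symm_half D'
  have hP2 : Nat.choose (2 * D' + 1) (D' + 1) =
      Nat.choose (2 * D') D' + Nat.choose (2 * D') (D' + 1) := Nat.choose_succ_succ _ _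
  omega

/-- **An `SL_m`-invariant polynomial function on `Sym^D` is constant along `SL_m`-orbits**:
`Φ(g · q) = Φ(q)` for `det g = 1` (IK §13, TeX L1192: "`Φ̄(gp) = 1 · γ(…)` for `g ∈ SL_m`";
BI 2017 §3). [cite: IkenmeyerKandasamy2019, §13 (proof of Thm. 4.2), TeX L1190–1193] -/
theorem aeval_formCoeff_linSubst_eq_of_mem_slInvariantsOfDegree {m D d : ℕ}
    {Φ : MvPolynomial (DegIdx (Fin m) D) ℂ} (hΦ : Φ ∈ slInvariantsOfDegree (Fin m) ℂ D d)
    (g : Matrix (Fin m) (Fin m) ℂ) (hg : g.det = 1) (q : MvPolynomial (Fin m) ℂ) :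
    aeval (formCoeff D (linSubst (Fin m) ℂ g q)) Φ = aeval (formCoeff D q) Φ := by
  obtain ⟨-, hinv⟩ := (mem_slInvariantsOfDegree_iff D d Φ).mp hΦ
  set γ : GL (Fin m) ℂ := Matrix.SpecialLinearGroup.toGL (⟨g, hg⟩ : Matrix.SpecialLinearGroup (Fin m) ℂ)
    with hγ
  have hγg : (γ : Matrix (Fin m) (Fin m) ℂ) = g := rfl
  have h1 : coordSubst D γ Φ = Φ := hinv ⟨g, hg⟩
  have h2 := aeval_formCoeff_coordSubst D γ (linSubstRep (Fin m) ℂ γ q) Φ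
  rw [h1, ← Module.End.mul_apply, ← map_mul, inv_mul_cancel, map_one, Module.End.one_apply,
    linSubstRep_apply, hγg] at h2
  exact h2

/-- Powers of an `SL_m`-invariant `Φ` of degree `d` with `Φ(p) = c`: `Φ^t` is a highest-weight
vector of weight `(-t·Dd/m, …, -t·Dd/m)` (an `SL_m`-invariant of degree `td` transforms under
`GL_m` by `det^{-tDd/m}`, `slInvariantsOfDegree_le_highestWeightSpace`) taking the constant value
`c^t` on `SL_m · p` (IK §13, TeX L1185–1193: products of highest-weight vectors; `Φ̄(gp)` for
`g ∈ SL_m`). [cite: IkenmeyerKandasamy2019, §13 (proof of Thm. 4.2), TeX L1185–1193] -/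
theorem pow_slInvariant_mem_highestWeightSpace_and_aeval {m D d : ℕ} (hm : 0 < m)
    (hdvd : m ∣ D * d) {Φ : MvPolynomial (DegIdx (Fin m) D) ℂ}
    (hΦ : Φ ∈ slInvariantsOfDegree (Fin m) ℂ D d) {p : MvPolynomial (Fin m) ℂ} {c : ℂ}
    (hc : aeval (formCoeff D p) Φ = c) (t : ℕ) :
    Φ ^ t ∈ highestWeightSpace (coordRep (Fin m) ℂ D)
        (fun _ : Fin m => -((t * (D * d / m) : ℕ) : ℤ)) ∧
      ∀ g : Matrix (Fin m) (Fin m) ℂ, g.det = 1 →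
        aeval (formCoeff D (linSubst (Fin m) ℂ g p)) (Φ ^ t) = c ^ t := by
  refine ⟨?_, fun g hg => ?_⟩
  · have hΦw := slInvariantsOfDegree_le_highestWeightSpace hm hdvd hΦ
    have hpow := pow_mem_highestWeightSpace_coordRep hΦw t
    have hwt : (t • fun _ : Fin m => -((D * d / m : ℕ) : ℤ)) =
        fun _ : Fin m => -((t * (D * d / m) : ℕ) : ℤ) := by
      funext i
      simp only [Pi.smul_apply, Nat.cast_mul]
      ring
    rw [hwt] at hpow
    exact hpow
  · rw [map_pow, aeval_formCoeff_linSubst_eq_of_mem_slInvariantsOfDegree hΦ g hg, hc]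

/-- **B3 — the fundamental invariant of the power sum and its powers** (IK 2020 §13, TeX
L1177–1193, citing [BI 2017, Prop. 3.25] = BI's power-sum proposition, tree `BI2017_prop_3_24`:
"there exists an `SL_m`-invariant function `Φ` … with `Φ(p) = 1` …; `Φ` has degree `m` and
`Φ(gp) = det(g)^D` if `D` is even; `Φ` has degree `2m` and `Φ(gp) = det(g)^{2D}` if `D` is odd
and `2m ≤ binom(2D, D)`", and "Let `f̄` be the product of `Φ^{e_Ξ-e_ϱ}` (`Φ^{(e_Ξ-e_ϱ)/2}` if
`D` is odd) and …"). For `3 ≤ D ≤ m`, IK's binomial hypothesis for odd `D`, and every `e`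
(even when `D` is odd — as `e_Ξ - e_ϱ` is, both being sums of terms `2⌈·⌉`): a highest-weight
vector `Ψ` of `ℂ[Sym^D ℂ^m]` of weight `(m × eD)^* = (-eD, …, -eD)` which takes one non-zero
constant value on the whole `SL_m`-orbit of `p = x₁^D + ⋯ + x_m^D`. (`Ψ = Φ^e`, `Φ` = the Cayley
invariant `cayleyP` of degree `m` with `Φ(p) = m!` for even `D`; `Ψ = Φ^{e/2}`, `Φ` = BI's tableau
invariant of degree `2m` with `Φ(p) = m!` for odd `D`; normalising `Φ(p) = 1` is immaterial.)
[cite: IkenmeyerKandasamy2019, §13 (proof of Thm. 4.2), TeX L1177–1193] -/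
theorem exists_slInvariant_hwv_aeval_psum_const {m D : ℕ} (hD : 3 ≤ D) (hDm : D ≤ m)
    (hodd : Odd D → 2 * (m - 1) ≤ Nat.choose (2 * (D - 1)) (D - 1)) (e : ℕ)
    (he : Odd D → Even e) :
    ∃ Ψ : MvPolynomial (DegIdx (Fin m) D) ℂ,
      Ψ ∈ highestWeightSpace (coordRep (Fin m) ℂ D) (fun _ : Fin m => -((e * D : ℕ) : ℤ)) ∧
      ∃ c : ℂ, c ≠ 0 ∧ ∀ g : Matrix (Fin m) (Fin m) ℂ, g.det = 1 →
        aeval (formCoeff D (linSubst (Fin m) ℂ g (MvPolynomial.psum (Fin m) ℂ D))) Ψ = c := by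
  have hm0 : 0 < m := by omega
  have hD0 : 0 < D := by omega
  have hfact : ((m.factorial : ℕ) : ℂ) ≠ 0 := Nat.cast_ne_zero.mpr (Nat.factorial_ne_zero m)
  have hpsum : (MvPolynomial.psum (Fin m) ℂ D) = ∑ a : Fin m, (X a : MvPolynomial (Fin m) ℂ) ^ D :=
    rfl
  rcases Nat.even_or_odd D with hDe | hDo
  · -- even `D`: the Cayley invariant of degree `m`, `Ψ = Φ^e`
    have hΦ := cayleyP_mem_slInvariantsOfDegree (k := ℂ) m D
    have hΦp : aeval (formCoeff D (MvPolynomial.psum (Fin m) ℂ D))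
        (cayleyP (k := ℂ) D (Equiv.refl (Fin m))) = (m.factorial : ℂ) := by
      rw [hpsum]
      exact BI2017_thm_3_18_2_powerSum (k := ℂ) hDe hD0 (Equiv.refl (Fin m))
    obtain ⟨hw, hev⟩ := pow_slInvariant_mem_highestWeightSpace_and_aeval hm0 ⟨D, by ring⟩ hΦ hΦp e
    refine ⟨_, ?_, (m.factorial : ℂ) ^ e, pow_ne_zero _ hfact, hev⟩
    have hq : D * m / m = D := Nat.mul_div_cancel D hm0
    rw [hq] at hw
    exact hw
  · -- odd `D`: BI's tableau invariant of degree `2m`, `Ψ = Φ^{e/2}`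
    have h2m : 2 * m ≤ Nat.choose (2 * D) D := two_mul_le_choose_of_le_choose_pred' hD hDm (hodd hDo)
    obtain ⟨β, hβ⟩ := exists_tableau_aeval_psum_eq_factorial (k := ℂ) (m := m) hD0 h2m
    have hΦ := tableauInvPoly_mem_slInvariantsOfDegree (k := ℂ) β
    have hΦp : aeval (formCoeff D (MvPolynomial.psum (Fin m) ℂ D))
        (tableauInvPoly (k := ℂ) D β id) = (m.factorial : ℂ) := by
      rw [hpsum]
      exact hβ
    obtain ⟨hw, hev⟩ := pow_slInvariant_mem_highestWeightSpace_and_aeval hm0 ⟨2 * D, by ring⟩ hΦ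
      hΦp (e / 2)
    refine ⟨_, ?_, (m.factorial : ℂ) ^ (e / 2), pow_ne_zero _ hfact, hev⟩
    have hq : e / 2 * (D * (2 * m) / m) = e * D := by
      rw [show D * (2 * m) = (2 * D) * m by ring, Nat.mul_div_cancel _ hm0, ← mul_assoc,
        Nat.div_mul_cancel (even_iff_two_dvd.mp (he hDo))]
    rw [hq] at hw
    exact hw

end IK2020

end Literature.Computability.AlgebraicComplexity

end
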